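import Literature.AnabelianGeometry.SemiGraphs.CoveringGraphGaloisCountable
import Literature.AnabelianGeometry.SemiGraphs.CoveringGraphConnected
import Mathlib.Topology.Instances.ZMod
import HarnessLib

/-!
# The incoherent bouquet `𝒢₀`: a connected, countable, quasi-coherent, Galois-countable semi-graph of
# anabelioids which is NOT coherent (route T, T7d∞ — countermodel base)

Mochizuki, *Semi-graphs of anabelioids*, Publ. RIMS **42** (2006), §1 p. 11 (semi-graphs), §2 Def. 2.1
p. 22 (semi-graphs of anabelioids, local presentation), Def. 2.3 (iii) p. 25 (quasi-coherent; coherent =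
quasi-coherent with topologically finitely generated constituents), §3 p. 33 (`B^temp`), Def. 3.5 (i)
p. 37 [cite: MochizukiSemiAnbd2006, Def 2.3(iii) p.25]; Galois-countability [IUTchI] Rmk. 2.5.3 (i) (T2)
p. 52 [cite: Mochizuki2012, IUTchI Rmk 2.5.3 (i) (T2), p. 52].

abc-iut cell, layer L3, route T · T7d∞ (seat abc-iut-L3-t5).  DEFINITIONS of an explicit object and its
elementary properties (no statement of the paper retyped, no `Prop` fact named), the base of the
countermodel of `CoveringGraphGaloisCountableNegative`: the companion positive file
`CoveringGraphCoherent` proves that {hypotheses of Prop. 3.6 ∧ COHERENT} is hereditary along connected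
tempered coverings of arbitrary degree; the countermodel shows "coherent" cannot be weakened to
"quasi-coherent" there.

* `P = ∏_ℕ ℤ/2` (product topology: compact, totally disconnected, second countable) with the elements
  `δ_m`, the basic-open-subgroup lemma `exists_finset_of_isOpen` (an open neighbourhood of `1` contains
  all `k` trivial on a finite set of coordinates, hence some `δ_m`), the restrictions
  `restrict i : P → (ℤ/2)^i` and the uniform level of a finite object of `B^temp(P)` (`exists_level`);
* objects of `B^temp(K)` with trivial action (`trivialObj`) or with `K` acting on a finite group through a
  continuous character (`charObj`);
* `bouquet` (`𝒢₀`): the loop (one vertex, one edge, both branches at the vertex) with vertex group `P`,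
  trivial edge group and trivial gluings; `bouquet_isConnected`, `_isCountable`, `_hasVertex`,
  **`bouquet_isGaloisCountable`** (the level coverings `levelCov i` split every finite object),
  **`bouquet_isQuasiCoherent`** (approximators `P → (ℤ/2)^i`), **`bouquet_not_isCoherent`** (`P` has
  infinitely many continuous characters to `ℤ/2`, against the (T4) count
  `card_setOf_monoidHom_isOpen_ker_le` for topologically finitely generated groups).

Honest framing: `𝒢₀` is not a Prop-3.6 object (a trivial edge group is never aloof as typed) — not
claimed; it carries exactly the hypotheses named.  Outside the [IUTchIII] Cor. 3.12 cone.
-/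

noncomputable section

open CategoryTheory Topology

namespace Literature.AnabelianGeometry.SemiGraphs

open Literature.AlgebraicGeometry.Frobenioids (IsConnectedObj)
open Literature.AlgebraicGeometry.Frobenioids.QuasiTemperoid.BTempConnected (hom_ρ ρ_one_apply
  ρ_mul_apply ρ_inv_apply)

namespace ProfiniteSemiGraph

namespace IncoherentBouquet

/-! ### 1. The group `P = ∏_ℕ ℤ/2` and its basic open subgroups -/

/-- The two-element group `ℤ/2`, written multiplicatively. [cite: MochizukiSemiAnbd2006, Def 2.3(iii) p.25] -/
abbrev M : Type := Multiplicative (ZMod 2)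

/-- The vertex group of the countermodel: `P = ∏_{ℕ} ℤ/2` with the product topology — a second countable
profinite group which is NOT topologically finitely generated. [cite: MochizukiSemiAnbd2006, Def 2.3(iii) p.25] -/
abbrev P : Type := ℕ → M

/-- The element `δ_m ∈ P`: `-1` at the coordinate `m`, `1` elsewhere. [cite: MochizukiSemiAnbd2006, Def 2.3(iii) p.25] -/
def δ (m : ℕ) : P := Pi.mulSingle m (Multiplicative.ofAdd 1)

/-- `δ_m(m) ≠ 1`. [cite: MochizukiSemiAnbd2006, Def 2.3(iii) p.25] -/
theorem δ_apply_self_ne_one (m : ℕ) : δ m m ≠ 1 := by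
  rw [δ, Pi.mulSingle_eq_same]
  decide

/-- `δ_m(t) = 1` for `t ≠ m`. [cite: MochizukiSemiAnbd2006, Def 2.3(iii) p.25] -/
theorem δ_apply_of_ne {m t : ℕ} (h : t ≠ m) : δ m t = 1 := by
  rw [δ, Pi.mulSingle_eq_of_ne h]

/-- **Basic open subgroups.** An open subset of `P` containing `1` contains, for some finite set `T` of
coordinates, every `k` which is trivial on `T` (product topology). [cite: MochizukiSemiAnbd2006, Def 2.3(iii) p.25] -/
theorem exists_finset_of_isOpen {U : Set P} (hU : IsOpen U) (h1 : (1 : P) ∈ U) :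
    ∃ T : Finset ℕ, ∀ k : P, (∀ t ∈ T, k t = 1) → k ∈ U := by
  obtain ⟨I, u, hu, hsub⟩ := isOpen_pi_iff.mp hU 1 h1
  refine ⟨I, fun k hk => hsub ?_⟩
  intro t ht
  rw [hk t (Finset.mem_coe.mp ht)]
  exact (hu t (Finset.mem_coe.mp ht)).2

/-- In particular an open subset of `P` containing `1` contains some `δ_m` (any `m` off the finite set
`T`): `P` has no open subgroup missing all the `δ_m`. [cite: MochizukiSemiAnbd2006, Def 2.3(iii) p.25] -/
theorem exists_δ_mem_of_isOpen {U : Set P} (hU : IsOpen U) (h1 : (1 : P) ∈ U) : ∃ m : ℕ, δ m ∈ U := by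
  obtain ⟨T, hT⟩ := exists_finset_of_isOpen hU h1
  obtain ⟨m, hm⟩ := Infinite.exists_notMem_finset T
  exact ⟨m, hT _ fun t ht => δ_apply_of_ne fun h => hm (h ▸ ht)⟩

/-- The restriction `P → (Fin i → ℤ/2)` to the first `i` coordinates. [cite: MochizukiSemiAnbd2006, Def 2.3(iii) p.25] -/
def restrict (i : ℕ) : P →* (Fin i → M) :=
  MonoidHom.pi fun t : Fin i => Pi.evalMonoidHom (fun _ : ℕ => M) t.1

/-- `restrict i k = 1` iff `k` is trivial on the first `i` coordinates. [cite: MochizukiSemiAnbd2006, Def 2.3(iii) p.25] -/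
theorem restrict_eq_one_iff (i : ℕ) (k : P) : restrict i k = 1 ↔ ∀ t, t < i → k t = 1 := by
  constructor
  · intro h t ht
    exact congrFun h ⟨t, ht⟩
  · intro h
    funext t
    exact h t.1 t.2

/-- `restrict i` is continuous. [cite: MochizukiSemiAnbd2006, Def 2.3(iii) p.25] -/
theorem continuous_restrict (i : ℕ) : Continuous (restrict i) :=
  continuous_pi fun t => continuous_apply t.1

/-- The kernel of `restrict i` is open. [cite: MochizukiSemiAnbd2006, Def 2.3(iii) p.25] -/
theorem isOpen_ker_restrict (i : ℕ) : IsOpen ((restrict i).ker : Set P) := by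
  have : ((restrict i).ker : Set P) = restrict i ⁻¹' {1} := by
    ext k; exact MonoidHom.mem_ker
  rw [this]
  exact (isOpen_discrete _).preimage (continuous_restrict i)

/-- **Uniform level for a finite object of `B^temp(P)`**: the stabilisers of the finitely many points are
open, so one level `i` works for all of them. [cite: MochizukiSemiAnbd2006, §3 p.33] -/
theorem exists_level (X : BTemp P) [Finite X.obj.V] :
    ∃ i : ℕ, ∀ k : P, restrict i k = 1 → ∀ x : X.obj.V, X.obj.ρ k x = x := by
  classical
  have hx : ∀ x : X.obj.V, ∃ T : Finset ℕ, ∀ k : P, (∀ t ∈ T, k t = 1) → X.obj.ρ k x = x :=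
    fun x => exists_finset_of_isOpen (X.property.2 x) (ρ_one_apply X x)
  choose T hT using hx
  haveI : Fintype X.obj.V := Fintype.ofFinite _
  refine ⟨(Finset.univ.sup fun x => (T x).sup id) + 1, fun k hk x => hT x k fun t ht => ?_⟩
  refine (restrict_eq_one_iff _ k).mp hk t (Nat.lt_succ_of_le ?_)
  exact (Finset.le_sup (f := id) ht).trans (Finset.le_sup (f := fun x => (T x).sup id) (Finset.mem_univ x))

/-! ### 2. Objects of `B^temp` with an action through a character, or with trivial action -/

section Objects

variable (K : Type) [Group K] [TopologicalSpace K]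

/-- The object of `B^temp(K)` on a countable set `X` with TRIVIAL action. [cite: MochizukiSemiAnbd2006, §3 p.33] -/
def trivialObj (X : Type) [Countable X] : BTemp K :=
  ⟨{ V := X, ρ := 1 }, ⟨inferInstance, fun x => by
    have : {g : K | ((1 : K →* End X) g : X ⟶ X) x = x} = Set.univ := Set.eq_univ_of_forall fun _ => rfl
    exact this ▸ isOpen_univ⟩⟩

/-- The trivial action is trivial. [cite: MochizukiSemiAnbd2006, §3 p.33] -/
@[simp] theorem trivialObj_ρ (X : Type) [Countable X] (g : K) (x : X) :
    (trivialObj K X).obj.ρ g x = x := rfl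

variable {K}

/-- The object of `B^temp(K)` on the finite group `A` with `K` acting by left multiplication through a
continuous homomorphism `χ : K → A` (`A` discrete). [cite: MochizukiSemiAnbd2006, §3 p.33] -/
def charObj {A : Type} [Group A] [TopologicalSpace A] [DiscreteTopology A] [Countable A] (χ : K →* A)
    (hχ : Continuous χ) : BTemp K :=
  letI : MulAction K A := MulAction.compHom A χ
  ⟨Action.ofMulAction K A, ⟨inferInstanceAs (Countable A), fun (x : A) => by
    have : {g : K | (Action.ofMulAction K A).ρ g x = x} = χ ⁻¹' {1} := by
      ext g
      simp only [Set.mem_setOf_eq, Action.ofMulAction_apply, Set.mem_preimage, Set.mem_singleton_iff]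
      change χ g * x = x ↔ _
      exact mul_eq_right
    rw [this]
    exact (isOpen_discrete _).preimage hχ⟩⟩

/-- The action of `charObj χ` in closed form: `k · x = χ(k) x`. [cite: MochizukiSemiAnbd2006, §3 p.33] -/
theorem charObj_ρ {A : Type} [Group A] [TopologicalSpace A] [DiscreteTopology A] [Countable A]
    (χ : K →* A) (hχ : Continuous χ) (g : K) (x : A) : (charObj χ hχ).obj.ρ g x = χ g * x := by
  letI : MulAction K A := MulAction.compHom A χ
  exact Action.ofMulAction_apply g x

end Objects


/-! ### 3. The base `𝒢₀`: one vertex with group `P`, one loop edge with trivial group -/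

/-- The underlying semi-graph of the countermodel: ONE vertex, ONE (closed) edge, both of whose branches
`false`, `true` abut to the vertex — a loop ([SemiAnbd] §1 p. 11). [cite: MochizukiSemiAnbd2006, §1 p.11] -/
abbrev loop : SemiGraph.{0} where
  Vertex := Unit
  Edge := Unit
  Branch := Bool
  edgeOf _ := ()
  abuts _ := some ()
  two_branches _ := ⟨false, true, Bool.false_ne_true, rfl, rfl, fun b _ => by cases b <;> simp⟩

/-- **The incoherent bouquet `𝒢₀`** ([SemiAnbd] Def. 2.1 p. 22, local presentation): on the loop, the
vertex group is `P = ∏_ℕ ℤ/2`, the edge group is trivial, the gluings are the trivial homomorphisms.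
A DEFINITION (countermodel base); nothing of the paper is asserted. [cite: MochizukiSemiAnbd2006, Def 2.1 p.22] -/
@[reducible] def bouquet : ProfiniteSemiGraph.{0} where
  graph := loop
  Gv _ := P
  Ge _ := PUnit
  brHom _ _ _ := 1

/-- `𝒢₀` is connected (every node of the subdivision is adjacent to the vertex or to a branch).
[cite: MochizukiSemiAnbd2006, §1 p.11] -/
theorem bouquet_isConnected : bouquet.IsConnected := by
  have hb : ∀ b : Bool, loop.subdivision.Reachable (Sum.inl ()) (Sum.inr (Sum.inr b)) := fun b =>
    (loop.subdivision_adj_of_nodeRel (SemiGraph.NodeRel.branch_vertex (G := loop) b () rfl)).symm.reachable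
  have he : loop.subdivision.Reachable (Sum.inl ()) (Sum.inr (Sum.inl ())) :=
    (hb false).trans
      (loop.subdivision_adj_of_nodeRel (SemiGraph.NodeRel.edge_branch (G := loop) false)).symm.reachable
  have hall : ∀ x : loop.Node, loop.subdivision.Reachable (Sum.inl ()) x := by
    rintro (⟨⟨⟩⟩ | ⟨⟨⟩⟩ | b)
    · exact SimpleGraph.Reachable.refl _
    · exact he
    · exact hb b
  haveI : Nonempty loop.Node := ⟨Sum.inl ()⟩
  exact ⟨⟨fun x y => (hall x).symm.trans (hall y)⟩⟩

/-- `𝒢₀` is countable. [cite: MochizukiSemiAnbd2006, §1 p.11] -/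
theorem bouquet_isCountable : bouquet.IsCountable := ⟨inferInstance, inferInstance⟩

/-- `𝒢₀` has a vertex. [cite: MochizukiSemiAnbd2006, Prop 3.6 p.38] -/
theorem bouquet_hasVertex : bouquet.HasVertex := ⟨()⟩

/-- The level-`i` finite étale covering of `𝒢₀`: over the vertex, the `P`-set `(ℤ/2)^i` (action through
the first `i` coordinates); over the edge, the same set with trivial action; identity gluings.
[cite: MochizukiSemiAnbd2006, Def 3.5(i) p.37] -/
def levelCov (i : ℕ) : CovObj bouquet where
  SV _ := charObj (K := P) (restrict i) (continuous_restrict i)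
  SE _ := trivialObj PUnit (Fin i → M)
  glue b v h := BTemp.isoOfEquiv (Equiv.refl (Fin i → M)) fun g (x : Fin i → M) => by
    change x = (charObj (K := P) (restrict i) (continuous_restrict i)).obj.ρ ((1 : PUnit →ₜ* P) g) x
    rw [charObj_ρ]
    change x = restrict i 1 * x
    rw [map_one, one_mul]

/-- The level coverings are finite. [cite: MochizukiSemiAnbd2006, Def 3.5(i) p.37] -/
theorem levelCov_isFinite (i : ℕ) : (levelCov i).IsFinite :=
  ⟨fun _ => inferInstanceAs (Finite (Fin i → M)), fun _ => inferInstanceAs (Finite (Fin i → M))⟩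

/-- The level coverings have nonempty fibres. [cite: MochizukiSemiAnbd2006, Def 3.5(i) p.37] -/
theorem levelCov_hasNonemptyFibres (i : ℕ) : (levelCov i).HasNonemptyFibres :=
  ⟨fun _ => ⟨(1 : Fin i → M)⟩, fun _ => ⟨(1 : Fin i → M)⟩⟩

/-- A point of the level-`i` covering over the vertex is fixed by `k ∈ P` iff `k` is trivial on the first
`i` coordinates. [cite: MochizukiSemiAnbd2006, Def 3.5(i) p.37] -/
theorem levelCov_ρ_eq_iff (i : ℕ) (v : Unit) (k : P) (x : Fin i → M) :
    ((levelCov i).SV v).obj.ρ k x = x ↔ restrict i k = 1 := by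
  change (charObj (K := P) (restrict i) (continuous_restrict i)).obj.ρ k x = x ↔ _
  rw [charObj_ρ]
  change (restrict i k * x : Fin i → M) = x ↔ _
  exact mul_eq_right

/-- **`𝒢₀` is Galois-countable** ([IUTchI] Rmk. 2.5.3 (i) (T2)): the level coverings split every finite
object constituentwise (a finite `P`-set with open stabilisers is fixed pointwise below some level; the
trivial edge group fixes everything). [cite: Mochizuki2012, IUTchI Rmk 2.5.3 (i) (T2), p. 52] -/
theorem bouquet_isGaloisCountable : bouquet.IsGaloisCountable := by
  refine ⟨bouquet_isCountable, levelCov, fun i => ⟨levelCov_isFinite i, levelCov_hasNonemptyFibres i⟩,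
    fun H hH => ?_⟩
  haveI : Finite (H.SV ()).obj.V := hH.finite_V ()
  obtain ⟨i, hi⟩ := exists_level (H.SV ())
  refine ⟨i, fun v x k hk s => ?_, fun e x g _ s => ?_⟩
  · obtain ⟨⟩ := v
    exact hi k ((levelCov_ρ_eq_iff i () k x).mp hk) s
  · obtain rfl : g = 1 := Subsingleton.elim _ _
    exact ρ_one_apply _ s

/-- **`𝒢₀` is quasi-coherent** ([SemiAnbd] Def. 2.3 (iii)): the approximator `P → (ℤ/2)^i`, trivial on
the edge, kills any finite family of local coverings once `i` is past their level.
[cite: MochizukiSemiAnbd2006, Def 2.3(iii) p.25] -/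
theorem bouquet_isQuasiCoherent : bouquet.IsQuasiCoherent := by
  intro Mb HV HE hHV _
  haveI : Finite (HV ()).obj.V := (hHV ()).2
  obtain ⟨i, hi⟩ := exists_level (HV ())
  haveI : Nonempty (Fin i → M) := ⟨1⟩
  let A : bouquet.Approximator :=
    { FV := fun _ => Fin i → M
      FE := fun _ => PUnit
      πV := fun _ => restrict i
      πE := fun _ => MonoidHom.id PUnit
      isOpen_ker_πV := fun _ => isOpen_ker_restrict i
      isOpen_ker_πE := fun _ => isOpen_discrete _
      brF := fun _ _ _ => 1
      brF_injective := fun _ _ _ => Function.injective_of_subsingleton _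
      comm := fun b v h => ⟨1, fun x => by
        change (1 : Fin i → M) = 1 * restrict i 1 * 1⁻¹
        simp⟩
      bounded := ⟨Nat.card (Fin i → M), Nat.card_pos, fun _ => dvd_rfl⟩ }
  refine ⟨A, fun v k hk x => ?_, fun e g _ x => ?_⟩
  · obtain ⟨⟩ := v
    exact hi k hk x
  · obtain rfl : g = 1 := Subsingleton.elim _ _
    exact ρ_one_apply _ x

/-- **`𝒢₀` is NOT coherent**: `P = ∏_ℕ ℤ/2` is not topologically finitely generated — a compact group
topologically generated by a finset `s` has at most `2 ^ |s|` continuous characters to `ℤ/2`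
(`card_setOf_monoidHom_isOpen_ker_le`, the (T4) count), whereas the coordinate projections of `P` are
infinitely many. [cite: MochizukiSemiAnbd2006, Def 2.3(iii) p.25] -/
theorem bouquet_not_isCoherent : ¬ bouquet.IsCoherent := by
  rintro ⟨-, hV, -⟩
  obtain ⟨s, hs⟩ := hV ()
  have hfin := (Literature.AnabelianGeometry.AbsoluteAnabelian.IsTopologicallyFinitelyGenerated.card_setOf_monoidHom_isOpen_ker_le
    (M := M) s hs).1
  -- the coordinate characters, pairwise distinct, all with open kernel
  let ev : ℕ → {ρ : P →* M | IsOpen (ρ.ker : Set P)} := fun t =>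
    ⟨Pi.evalMonoidHom (fun _ : ℕ => M) t, by
      have : ((Pi.evalMonoidHom (fun _ : ℕ => M) t).ker : Set P) = (fun k : P => k t) ⁻¹' {1} := by
        ext k; exact MonoidHom.mem_ker
      change IsOpen ((Pi.evalMonoidHom (fun _ : ℕ => M) t).ker : Set P)
      rw [this]
      exact (isOpen_discrete _).preimage (continuous_apply t)⟩
  have hinj : Function.Injective ev := by
    intro t t' h
    by_contra hne
    have h1 : (ev t).1 (δ t) = (ev t').1 (δ t) := by rw [h]
    change δ t t = δ t t' at h1
    rw [δ_apply_of_ne (Ne.symm hne)] at h1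
    exact δ_apply_self_ne_one t h1
  haveI := hfin
  haveI := Infinite.of_injective ev hinj
  exact not_finite {ρ : P →* M | IsOpen (ρ.ker : Set P)}

end IncoherentBouquet

end ProfiniteSemiGraph

end Literature.AnabelianGeometry.SemiGraphs
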